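import Literature.MathematicalPhysics.QuantumFieldTheory.Balaban1983to89.B8Thm2TorusLettersPer
import Literature.MathematicalPhysics.QuantumFieldTheory.Balaban1983to89.B8TorusPeriodization
import Literature.MathematicalPhysics.QuantumFieldTheory.Balaban1983to89.B8TorusShiftStencils
import Literature.MathematicalPhysics.QuantumFieldTheory.Balaban1983to89.B9Eq321LandauMultiplierIffZd
import Literature.MathematicalPhysics.QuantumFieldTheory.Balaban1983to89.B8Prop5KLevelLetters
import Literature.MathematicalPhysics.QuantumFieldTheory.Balaban1983to89.B8Prop5JoinSectE
import Literature.MathematicalPhysics.QuantumFieldTheory.Balaban1983to89.B8Prop5JoinHFP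

/-!
# `Balaban1983to89.B8Thm2TorusLettersPerConv` — the π-CONVERTER of RULING #4 v3: from the v3 letters `LettersAtPer` (laws at `P`-PERIODIC
# arguments) to the Prop.-5 engines' letters `g Δ q qs Aw c H′` with their BOUND ∕ READS ∕ REALITY ∕ `τ` laws at ALL arguments and the
# IDENTITY laws (E1), (E2), (E11), (U1), (U2) at periodic arguments (sub-row «G-B8-T2S», layer 2 of `lit-balaban-t2s-1/g2/V3-DESIGN.md`)

statement-level skeleton of published theorems with citation tags; proofs where landed; nothing here is a claim about the
Yang–Mills mass gap

T. Bałaban, *Spaces of regular gauge field configurations …*, Commun. Math. Phys. **99** (1985) 75–102 `[Balaban1985RegularSpaces]`: (1.91)–(1.92)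
p. 91, (1.95)–(1.98) p. 92, (1.101)–(1.103) p. 93, Prop. 5 p. 94, p. 77 («Ω_j = T_η»).  T. Bałaban, *Propagators for lattice gauge theories in a
background field*, Commun. Math. Phys. **99** (1985) 389–434 `[Balaban1985BackgroundPropagators]`: Thm 3.1 p. 397, Thm 3.2 p. 398, (3.19)–(3.25)
pp. 393–394.  STATUS: published, refereed.

CITATION HEADER (lean-in-tree rule).  Cell `lit-balaban`, seat `lit-balaban-t2s-1` (gen 2).  WHAT IS PROVED.  Given `lt : LettersAtPer … η m α₀ P U₀`
(v3: [4]'s letters on `T_η` read on `ℤᵈ`, laws at `P`-periodic arguments, `B8Thm2TorusLettersPer`) at a `P`-periodic background and a truncation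
`1 ≤ n ≤ m`, the HYBRID LETTERS `gH = G′∘π`, `AwH = 𝔄∘π`, `cH = C∘π`, `HH = H′∘π` (`π` = periodisation of `B8TorusPeriodization`), `ΔH` = the
concrete covariant Laplacian, `qsH` = the concrete `Q′ᵀ` (`QT`), `qH` = the concrete iterated average on the tower ∕ `Q′∘π` off it, satisfy — in
EXACTLY the binder shapes of `B8SockHFPTraceFree.sockHFP_body_of_join_RD_traceFree` ∕ `B8Prop5StepUniq.prop5_unique_step` at `Ω_j = ℤᵈ`,
`Λ = torusLam n` —: the reads laws `hΔ`, `hqs`, `hq`, `hq0` and the bound ∕ reality ∕ `τ` laws `hH0`, `hH1`, `hH2`, `hHsupp`, `hHequiv`, `hG`,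
`hGsupp`, `hGreal`, `hRbd` (constant `B_R + 2`: `R_H f = (f − πf) + R(πf)`), `hRreal`, `hHτ`, `hGτ`, `hRτ` AT ALL ARGUMENTS (§3), and the identity laws
`g_rightΩ` (E1), `c_range` (E2), `hQH` (E11), `g_leftB` (U1), `c_left'` (U2) AT `P`-PERIODIC ARGUMENTS (§4; the hybrid letters AGREE with the v3
letters on periodic arguments, §2).  This is the whole interface of the engines except that the five identity laws keep a periodicity premise —
the residual re-thread of layer 3 (their ≈ 6 application sites read periodic arguments in the torus run).

HONEST SCOPE.  Elementary algebra on hypothesis bundles; [4] NOT proved; `LettersAtPer` is inhabited by nothing here; no engine is re-run here (no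
v3 endpoint yet); count-neutral; N05 ∕ `stub_PV3A` NOT discharged; nothing continuum ∕ ℝ⁴ ∕ OS ∕ mass-gap ∕ Clay — the Yang–Mills mass gap is NOT
proved.  No `sorry`, no `… : Prop` fact, no `instance`, no `notation`.
-/

noncomputable section

open scoped BigOperators

namespace Literature.MathematicalPhysics.QuantumFieldTheory.Balaban1983to89.B8Thm2TorusLettersPerConv

open B7Prop1Explicit B7Prop2Explicit B7Prop1Local
open B7Eq78Linearization (zdBlocking QprimeIter QprimeIter_add QprimeIter_smul)
open B8Ineq132 (covDerivFwd)
open B8Eq119TwistedAxial (bgT)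
open B8Eq140Level (SideTouches)
open B8Eq138LandauZd (covLap QT)
open B8Eq1117Concrete (XSpace)
open B8Prop5ContractionKLevel (Bd2)
open B8LambdaSpaceKLevel (wt)
open B12Ineq417Flat (shiftCfg shiftCfg_apply)
open B8Thm4TorusAt (torusLam mem_torusLam_iff torusLam_self)
open B8TorusShiftStencils (covLap_shiftCfg)
open B9Eq321LandauMultiplierIffZd (QT_add QT_smul)
open B8Prop5KLevelLetters (covLap_sub)
open B8Prop5JoinSectE (covLap_smul)
open B8Prop5JoinHFP (covLap_neg')
open B8TorusPeriodization (pmod perz perz_apply perz_per perz_eq_self_of_per perzFam perzFam_per perzFam_eq_self_of_per perzFam_apply_of_le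
  perzFam_apply_of_not_le perzₗ perzₗ_apply perzFamₗ perzFamₗ_apply perzX perzX_apply perzX_per perzX_eq_self_of_per norm_perzX_le bd2_perz
  bd2_sub_perz perzX_neg_star)
open B8Thm2TorusLettersPer (LettersAtPer LettersPerTau)

-- `Site` alone could resolve to the torus sites of `Setup.lean`; re-export the `ℤ^d` sites of `B7Prop1Explicit`.
export B7Prop1Explicit (Site)

variable {d : ℕ}

/-! ## §1 The concrete letters as `ℂ`-linear maps and the hybrid letters -/

section Letters

variable {𝔸 : Type*} [CStarAlgebra 𝔸]

/-- **`Δ^η_{U₀}` as a `ℂ`-linear map of site functions** ([4] (3.23)). [cite: Balaban1985BackgroundPropagators, (3.23) p.394] -/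
def covLapₗ (η : ℝ) (U₀ : Site d → Fin d → 𝔸ˣ) : (Site d → 𝔸) →ₗ[ℂ] (Site d → 𝔸) where
  toFun f := fun x => covLap η U₀ f x
  map_add' f g := by
    funext x
    have h : f + g = f - (-g) := by simp
    rw [h, covLap_sub, covLap_neg', sub_neg_eq_add]
    rfl
  map_smul' c f := by
    funext x
    exact covLap_smul η U₀ c f x

/-- unfolding. [cite: Balaban1985BackgroundPropagators, (3.23) p.394] -/
@[simp] theorem covLapₗ_apply (η : ℝ) (U₀ : Site d → Fin d → 𝔸ˣ) (f : Site d → 𝔸) (x : Site d) : covLapₗ η U₀ f x = covLap η U₀ f x := rfl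

/-- **`Q′(U₀)ᵀ` on `𝔅_n` as a `ℂ`-linear map of multipliers** ([4] (3.24)). [cite: Balaban1985BackgroundPropagators, (3.24) p.394] -/
def QTₗ (L n : ℕ) (Λs : ℕ → Set (Site d)) (U₀ : Site d → Fin d → 𝔸ˣ) : (ℕ → Site d → 𝔸) →ₗ[ℂ] (Site d → 𝔸) where
  toFun μ := fun x => QT L n Λs U₀ μ x
  map_add' μ μ' := funext fun x => QT_add L U₀ n Λs μ μ' x
  map_smul' c μ := funext fun x => QT_smul L U₀ n Λs c μ x

/-- unfolding. [cite: Balaban1985BackgroundPropagators, (3.24) p.394] -/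
@[simp] theorem QTₗ_apply (L n : ℕ) (Λs : ℕ → Set (Site d)) (U₀ : Site d → Fin d → 𝔸ˣ) (μ : ℕ → Site d → 𝔸) (x : Site d) :
    QTₗ L n Λs U₀ μ x = QT L n Λs U₀ μ x := rfl

variable {L : ℕ} {BG BR B₀'H B₂' B₀ B₀β cB β : ℝ} {len : Site d → ℝ} {η : ℝ} {m : ℕ} {α₀ : ℝ} {P : ℤ} {U₀ : Site d → Fin d → 𝔸ˣ}

/-- **The hybrid `Q′`: the concrete iterated average `Q′_n(U₀)` at the top level `j = n` of `torusLam n`, the v3 letter at the periodised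
argument at the other levels** (so that it READS as print's `Q′` at every argument and AGREES with the v3 letter at periodic arguments).
[cite: Balaban1985BackgroundPropagators, (3.19) p.393; Balaban1985RegularSpaces, (1.28)–(1.29) p.81, p.77] -/
def qH (lt : LettersAtPer (𝔸 := 𝔸) L BG BR B₀'H B₂' B₀ B₀β cB β len η m α₀ P U₀) (n : ℕ) : (Site d → 𝔸) →ₗ[ℂ] (ℕ → Site d → 𝔸) where
  toFun f := fun j y => if j = n then QprimeIter (zdBlocking d L) (bgT L U₀) j f y else lt.Qp n (perz P f) j y
  map_add' f g := by
    funext j y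
    by_cases hj : j = n
    · simp only [hj, if_true, Pi.add_apply]
      exact congrFun (QprimeIter_add (G := zdBlocking d L) (T := bgT L U₀) f g n) y
    · simp only [hj, if_false, Pi.add_apply]
      rw [show perz P (f + g) = perz P f + perz P g from rfl, map_add, Pi.add_apply, Pi.add_apply]
  map_smul' c f := by
    funext j y
    by_cases hj : j = n
    · simp only [hj, if_true, Pi.smul_apply, RingHom.id_apply]
      exact congrFun (QprimeIter_smul (G := zdBlocking d L) (T := bgT L U₀) c f n) y
    · simp only [hj, if_false, Pi.smul_apply, RingHom.id_apply]
      rw [show perz P (c • f) = c • perz P f from rfl, map_smul, Pi.smul_apply, Pi.smul_apply]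

/-- unfolding of the hybrid `Q′`. [cite: Balaban1985BackgroundPropagators, (3.19) p.393] -/
theorem qH_apply (lt : LettersAtPer (𝔸 := 𝔸) L BG BR B₀'H B₂' B₀ B₀β cB β len η m α₀ P U₀) (n : ℕ) (f : Site d → 𝔸) (j : ℕ) (y : Site d) :
    qH lt n f j y = if j = n then QprimeIter (zdBlocking d L) (bgT L U₀) j f y else lt.Qp n (perz P f) j y := rfl

/-- **`gH = G′ ∘ π`.** [cite: Balaban1985RegularSpaces, (1.95) p.92; Balaban1985BackgroundPropagators, Thm 3.1 p.397] -/
def gH (lt : LettersAtPer (𝔸 := 𝔸) L BG BR B₀'H B₂' B₀ B₀β cB β len η m α₀ P U₀) (n : ℕ) : (Site d → 𝔸) →ₗ[ℂ] (Site d → 𝔸) :=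
  lt.Gp n ∘ₗ perzₗ P

/-- **`AwH = 𝔄 ∘ π`.** [cite: Balaban1985RegularSpaces, (1.95) p.92] -/
def AwH (lt : LettersAtPer (𝔸 := 𝔸) L BG BR B₀'H B₂' B₀ B₀β cB β len η m α₀ P U₀) (n : ℕ) : (ℕ → Site d → 𝔸) →ₗ[ℂ] (ℕ → Site d → 𝔸) :=
  lt.Aw n ∘ₗ perzFamₗ L P n

/-- **`cH = C ∘ π`.** [cite: Balaban1985RegularSpaces, (1.96)–(1.97) p.92; Balaban1985BackgroundPropagators, Thm 3.2 p.398] -/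
def cH (lt : LettersAtPer (𝔸 := 𝔸) L BG BR B₀'H B₂' B₀ B₀β cB β len η m α₀ P U₀) (n : ℕ) : (ℕ → Site d → 𝔸) →ₗ[ℂ] (ℕ → Site d → 𝔸) :=
  lt.Cinv n ∘ₗ perzFamₗ L P n

/-- **`HH = H′ ∘ π`.** [cite: Balaban1985RegularSpaces, (1.91)–(1.92) p.91] -/
def HH (lt : LettersAtPer (𝔸 := 𝔸) L BG BR B₀'H B₂' B₀ B₀β cB β len η m α₀ P U₀) (n : ℕ) : XSpace d n 𝔸 →ₗ[ℂ] (Site d → 𝔸) :=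
  lt.Hp n ∘ₗ perzX L P n

/-- unfolding. [cite: Balaban1985RegularSpaces, (1.95) p.92] -/
@[simp] theorem gH_apply (lt : LettersAtPer (𝔸 := 𝔸) L BG BR B₀'H B₂' B₀ B₀β cB β len η m α₀ P U₀) (n : ℕ) (f : Site d → 𝔸) :
    gH lt n f = lt.Gp n (perz P f) := rfl

/-- unfolding. [cite: Balaban1985RegularSpaces, (1.95) p.92] -/
@[simp] theorem AwH_apply (lt : LettersAtPer (𝔸 := 𝔸) L BG BR B₀'H B₂' B₀ B₀β cB β len η m α₀ P U₀) (n : ℕ) (μ : ℕ → Site d → 𝔸) :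
    AwH lt n μ = lt.Aw n (perzFam L P n μ) := rfl

/-- unfolding. [cite: Balaban1985RegularSpaces, (1.96) p.92] -/
@[simp] theorem cH_apply (lt : LettersAtPer (𝔸 := 𝔸) L BG BR B₀'H B₂' B₀ B₀β cB β len η m α₀ P U₀) (n : ℕ) (μ : ℕ → Site d → 𝔸) :
    cH lt n μ = lt.Cinv n (perzFam L P n μ) := rfl

/-- unfolding. [cite: Balaban1985RegularSpaces, (1.91) p.91] -/
@[simp] theorem HH_apply (lt : LettersAtPer (𝔸 := 𝔸) L BG BR B₀'H B₂' B₀ B₀β cB β len η m α₀ P U₀) (n : ℕ) (X : XSpace d n 𝔸) :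
    HH lt n X = lt.Hp n (perzX L P n X) := rfl

end Letters

/-! ## §2 The hybrid letters agree with the v3 letters at periodic arguments -/

section Agree

variable {𝔸 : Type*} [CStarAlgebra 𝔸]
variable {L : ℕ} {BG BR B₀'H B₂' B₀ B₀β cB β : ℝ} {len : Site d → ℝ} {η : ℝ} {m : ℕ} {α₀ : ℝ} {P : ℤ} {U₀ : Site d → Fin d → 𝔸ˣ}
variable (lt : LettersAtPer (𝔸 := 𝔸) L BG BR B₀'H B₂' B₀ B₀β cB β len η m α₀ P U₀) {n : ℕ}

/-- `gH x = G′x` at periodic `x`. [cite: Balaban1985RegularSpaces, (1.95) p.92] -/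
theorem gH_of_per {x : Site d → 𝔸} (hx : ∀ (z : Site d) (i : Fin d), x (z + P • e i) = x z) : gH lt n x = lt.Gp n x := by
  rw [gH_apply, perz_eq_self_of_per hx]

/-- `qH f = Q′f` at periodic `f` (`1 ≤ n ≤ m`). [cite: Balaban1985BackgroundPropagators, (3.19) p.393] -/
theorem qH_of_per (hn : 1 ≤ n) (hnm : n ≤ m) {f : Site d → 𝔸} (hf : ∀ (z : Site d) (i : Fin d), f (z + P • e i) = f z) :
    qH lt n f = lt.Qp n f := by
  funext j y
  rw [qH_apply]
  by_cases hj : j = n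
  · rw [if_pos hj]; subst hj
    exact (lt.qp_reads j hn hnm f hf j le_rfl y (by rw [torusLam_self]; exact Set.mem_univ _)).symm
  · rw [if_neg hj, perz_eq_self_of_per hf]

/-- `AwH μ = 𝔄μ` at level-periodic `μ`. [cite: Balaban1985RegularSpaces, (1.95) p.92] -/
theorem AwH_of_per {μ : ℕ → Site d → 𝔸} (hμ : ∀ j, j ≤ n → ∀ (y : Site d) (i : Fin d), μ j (y + (P / (L : ℤ) ^ j) • e i) = μ j y) :
    AwH lt n μ = lt.Aw n μ := by
  rw [AwH_apply, perzFam_eq_self_of_per hμ]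

/-- `cH μ = Cμ` at level-periodic `μ`. [cite: Balaban1985RegularSpaces, (1.96) p.92] -/
theorem cH_of_per {μ : ℕ → Site d → 𝔸} (hμ : ∀ j, j ≤ n → ∀ (y : Site d) (i : Fin d), μ j (y + (P / (L : ℤ) ^ j) • e i) = μ j y) :
    cH lt n μ = lt.Cinv n μ := by
  rw [cH_apply, perzFam_eq_self_of_per hμ]

/-- `HH X = H′X` at level-periodic `X`. [cite: Balaban1985RegularSpaces, (1.91) p.91] -/
theorem HH_of_per {X : XSpace d n 𝔸} (hX : ∀ (p : Fin (n + 1) × Site d) (i : Fin d), X (p.1, p.2 + (P / (L : ℤ) ^ (p.1 : ℕ)) • e i) = X p) :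
    HH lt n X = lt.Hp n X := by
  rw [HH_apply, perzX_eq_self_of_per hX]

/-- `qsH μ = Q′ᵀμ` (pointwise, as functions) at level-periodic `μ` (`1 ≤ n ≤ m`). [cite: Balaban1985BackgroundPropagators, (3.24) p.394] -/
theorem QTₗ_of_per (hn : 1 ≤ n) (hnm : n ≤ m) {μ : ℕ → Site d → 𝔸}
    (hμ : ∀ j, j ≤ n → ∀ (y : Site d) (i : Fin d), μ j (y + (P / (L : ℤ) ^ j) • e i) = μ j y) :
    QTₗ L n (torusLam (d := d) n) U₀ μ = lt.QpT n μ := by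
  funext x
  rw [QTₗ_apply]
  exact (lt.qpT_reads n hn hnm μ hμ x (Set.mem_univ _)).symm

/-- `ΔH f = Δf` (as functions) at periodic `f` (`1 ≤ n ≤ m`). [cite: Balaban1985BackgroundPropagators, (3.23) p.394] -/
theorem covLapₗ_of_per (hn : 1 ≤ n) (hnm : n ≤ m) {f : Site d → 𝔸} (hf : ∀ (z : Site d) (i : Fin d), f (z + P • e i) = f z) :
    covLapₗ η U₀ f = lt.lapU n f := by
  funext x
  rw [covLapₗ_apply, lt.lapU_reads n hn hnm f hf x (Set.mem_univ _), Set.indicator_univ]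

/-- The covariant Laplacian of a periodic function at a periodic background is periodic. [cite: Balaban1985BackgroundPropagators, (3.23) p.394; Balaban1987RG1, (4.16) p.285] -/
theorem covLap_per (hU₀ : ∀ (z : Site d) (i : Fin d), U₀ (z + P • e i) = U₀ z) {f : Site d → 𝔸}
    (hf : ∀ (z : Site d) (i : Fin d), f (z + P • e i) = f z) :
    ∀ (z : Site d) (i : Fin d), covLap η U₀ f (z + P • e i) = covLap η U₀ f z := by
  intro z i
  have hU : shiftCfg (P • e i) U₀ = U₀ := funext fun x => hU₀ x i
  have hF : shiftCfg (P • e i) f = f := funext fun x => hf x i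
  rw [← covLap_shiftCfg η (P • e i) U₀ f z, hU, hF]

end Agree

/-! ## §3 The laws at ALL arguments (reads, bounds, reality, `τ`) -/

section AllArgs

variable {𝔸 : Type*} [CStarAlgebra 𝔸]
variable {L : ℕ} {BG BR B₀'H B₂' B₀ B₀β cB β : ℝ} {len : Site d → ℝ} {η : ℝ} {m : ℕ} {α₀ : ℝ} {P : ℤ} {U₀ : Site d → Fin d → 𝔸ˣ}
variable (lt : LettersAtPer (𝔸 := 𝔸) L BG BR B₀'H B₂' B₀ B₀β cB β len η m α₀ P U₀) {n : ℕ}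

/-- (E3) for `ΔH`, all arguments. [cite: Balaban1985BackgroundPropagators, (3.23) p.394] -/
theorem hΔ_H : ∀ (f : Site d → 𝔸), ∀ x ∈ (Set.univ : Set (Site d)), covLapₗ η U₀ f x = covLap η U₀ ((Set.univ : Set (Site d)).indicator f) x :=
  fun f x _ => by rw [covLapₗ_apply, Set.indicator_univ]

/-- (E4) for `qsH`, all arguments. [cite: Balaban1985BackgroundPropagators, (3.24) p.394] -/
theorem hqs_H : ∀ (μ : ℕ → Site d → 𝔸), ∀ x ∈ (Set.univ : Set (Site d)),
    QTₗ L n (torusLam (d := d) n) U₀ μ x = QT L n (torusLam (d := d) n) U₀ μ x := fun _ _ _ => rfl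

/-- (E5) for `qH`, all arguments. [cite: Balaban1985BackgroundPropagators, (3.19) p.393; Balaban1985RegularSpaces, (1.28) p.81] -/
theorem hq_H : ∀ (f : Site d → 𝔸) (j : ℕ), j ≤ n → ∀ y ∈ torusLam (d := d) n j, qH lt n f j y = QprimeIter (zdBlocking d L) (bgT L U₀) j f y := by
  intro f j _ y hy
  have hj : j = n := (mem_torusLam_iff n j y).1 hy
  rw [qH_apply, if_pos hj]

/-- (U3) for `qH` at the top structure `n = m`, all arguments: `Q′ = 0` off `𝔅_m`. [cite: Balaban1985RegularSpaces, (1.28)–(1.29) p.81] -/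
theorem hq0_H (hm : 1 ≤ m) : ∀ (f : Site d → 𝔸) (j : ℕ) (y : Site d), ¬ (j ≤ m ∧ y ∈ torusLam (d := d) m j) → qH lt m f j y = 0 := by
  intro f j y h
  have hj : j ≠ m := by
    rintro rfl
    exact h ⟨le_rfl, by rw [torusLam_self]; exact Set.mem_univ _⟩
  rw [qH_apply, if_neg hj]
  exact lt.qp_zero_off hm (perz P f) (perz_per P f) j y h

/-- (E6) for `HH`, all arguments. [cite: Balaban1985RegularSpaces, (1.92) p.91] -/
theorem hH0_H (hn : 1 ≤ n) (hnm : n ≤ m) (hB₀'H : 0 ≤ B₀'H) : ∀ (X : XSpace d n 𝔸) (x : Site d), ‖HH lt n X x‖ ≤ B₀'H * ‖X‖ := fun X x =>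
  (lt.hp_sup n hn hnm (perzX L P n X) (perzX_per L P n X) x).trans (mul_le_mul_of_nonneg_left (norm_perzX_le L P n X) hB₀'H)

/-- (E7) for `HH`, all arguments. [cite: Balaban1985RegularSpaces, (1.92) p.91] -/
theorem hH1_H (hn : 1 ≤ n) (hnm : n ≤ m) (hB₀'H : 0 ≤ B₀'H) : ∀ j, j ≤ n → ∀ (X : XSpace d n 𝔸),
    ∀ p ∈ {b : Site d × Fin d | SideTouches (Set.univ : Set (Site d)) b.1 b.2},
      wt L η j * ‖covDerivFwd η U₀ p.2 (HH lt n X) p.1‖ ≤ B₀'H * ‖X‖ := fun j hj X p hp =>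
  (lt.hp_grad n hn hnm j hj (perzX L P n X) (perzX_per L P n X) p hp).trans (mul_le_mul_of_nonneg_left (norm_perzX_le L P n X) hB₀'H)

/-- (E8) for `HH`, all arguments. [cite: Balaban1985RegularSpaces, (1.92) p.91] -/
theorem hH2_H (hn : 1 ≤ n) (hnm : n ≤ m) (hB₂' : 0 ≤ B₂') : ∀ X : XSpace d n 𝔸,
    Bd2 L η n (fun _ => (Set.univ : Set (Site d))) (covLap η U₀ (HH lt n X)) (B₂' * ‖X‖) := fun X =>
  (lt.hp_lap n hn hnm (perzX L P n X) (perzX_per L P n X)).mono (mul_le_mul_of_nonneg_left (norm_perzX_le L P n X) hB₂')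

/-- (E9) for `HH` (vacuous at `Ω₀ = ℤᵈ`). [cite: Balaban1985RegularSpaces, (1.92) p.91] -/
theorem hHsupp_H : ∀ (X : XSpace d n 𝔸) (x : Site d), x ∉ (Set.univ : Set (Site d)) → HH lt n X x = 0 :=
  fun _ x hx => absurd (Set.mem_univ x) hx

/-- (E10) for `HH`, all arguments. [cite: Balaban1985RegularSpaces, p.93 (real configurations)] -/
theorem hHequiv_H (hn : 1 ≤ n) (hnm : n ≤ m) : ∀ X Y : XSpace d n 𝔸, (∀ p, Y p = -star (X p)) → ∀ x, HH lt n Y x = -star (HH lt n X x) :=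
  fun X Y h x => lt.hp_real n hn hnm (perzX L P n X) (perzX L P n Y) (perzX_per L P n X) (perzX_per L P n Y) (perzX_neg_star h) x

/-- (E12) for `gH`, all arguments ([4] Thm 3.1 (3.42)₁,₂). [cite: Balaban1985RegularSpaces, (1.101) p.93; Balaban1985BackgroundPropagators, Thm 3.1 p.397] -/
theorem hG_H (hn : 1 ≤ n) (hnm : n ≤ m) : ∀ (f : Site d → 𝔸) (r : ℝ), 0 ≤ r → Bd2 L η n (fun _ => (Set.univ : Set (Site d))) f r →
    (∀ x, ‖gH lt n f x‖ ≤ BG * r) ∧ ∀ j, j ≤ n → ∀ p ∈ {b : Site d × Fin d | SideTouches (Set.univ : Set (Site d)) b.1 b.2},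
      wt L η j * ‖covDerivFwd η U₀ p.2 (gH lt n f) p.1‖ ≤ BG * r := fun f r hr hb => by
  rw [gH_apply]
  exact lt.gp_sup_grad n hn hnm (perz P f) (perz_per P f) r hr (bd2_perz hb)

/-- (E13) for `gH` (vacuous at `Ω₀ = ℤᵈ`). [cite: Balaban1985RegularSpaces, (1.95) p.92] -/
theorem hGsupp_H : ∀ (f : Site d → 𝔸) (x : Site d), x ∉ (Set.univ : Set (Site d)) → gH lt n f x = 0 :=
  fun _ x hx => absurd (Set.mem_univ x) hx

/-- (E14) for `gH`, all arguments. [cite: Balaban1985RegularSpaces, p.93] -/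
theorem hGreal_H (hn : 1 ≤ n) (hnm : n ≤ m) : ∀ f : Site d → 𝔸,
    (∀ j, j ≤ n → ∀ x ∈ (Set.univ : Set (Site d)), IsSelfAdjoint (f x)) → ∀ x, IsSelfAdjoint (gH lt n f x) := fun f hf x => by
  rw [gH_apply]
  exact lt.gp_real n hn hnm (perz P f) (perz_per P f) (fun j hj z _ => hf j hj (pmod P z) (Set.mem_univ _)) x

/-- The remainder composite of the hybrid letters at ANY argument is `G′Q′ᵀCQ′G′` of the v3 letters at the PERIODISED argument.
[cite: Balaban1985RegularSpaces, (1.98) p.92] -/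
theorem remainder_H (hn : 1 ≤ n) (hnm : n ≤ m) (f : Site d → 𝔸) :
    gH lt n (QTₗ L n (torusLam (d := d) n) U₀ (cH lt n (qH lt n (gH lt n f)))) =
      lt.Gp n (lt.QpT n (lt.Cinv n (lt.Qp n (lt.Gp n (perz P f))))) := by
  have hg : ∀ (z : Site d) (i : Fin d), lt.Gp n (perz P f) (z + P • e i) = lt.Gp n (perz P f) z :=
    lt.gp_per n hn hnm (perz P f) (perz_per P f)
  have hq : qH lt n (gH lt n f) = lt.Qp n (lt.Gp n (perz P f)) := by rw [gH_apply, qH_of_per lt hn hnm hg]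
  have hqper := lt.qp_per n hn hnm _ hg
  have hc : cH lt n (qH lt n (gH lt n f)) = lt.Cinv n (lt.Qp n (lt.Gp n (perz P f))) := by rw [hq, cH_of_per lt hqper]
  have hcper := lt.cinv_per n hn hnm _ hqper
  have hs : QTₗ L n (torusLam (d := d) n) U₀ (cH lt n (qH lt n (gH lt n f))) = lt.QpT n (lt.Cinv n (lt.Qp n (lt.Gp n (perz P f)))) := by
    rw [hc, QTₗ_of_per lt hn hnm hcper]
  have hsper := lt.qpT_per n hn hnm _ hcper
  rw [hs, gH_of_per lt hsper]

/-- (E15) for the hybrid remainder `R_H = 1 − gH qsH cH qH gH`, all arguments, constant `B_R + 2`: `R_H f = (f − πf) + R(πf)`.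
[cite: Balaban1985RegularSpaces, (1.98) p.92] -/
theorem hRbd_H (hn : 1 ≤ n) (hnm : n ≤ m) : ∀ (f : Site d → 𝔸) (r : ℝ), 0 ≤ r → Bd2 L η n (fun _ => (Set.univ : Set (Site d))) f r →
    Bd2 L η n (fun _ => (Set.univ : Set (Site d))) (f - gH lt n (QTₗ L n (torusLam (d := d) n) U₀ (cH lt n (qH lt n (gH lt n f)))))
      ((BR + 2) * r) := by
  intro f r hr hb
  rw [remainder_H lt hn hnm f]
  have h1 : Bd2 L η n (fun _ => (Set.univ : Set (Site d))) (f - perz P f) (2 * r) := bd2_sub_perz hb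
  have h2 := lt.r_bound n hn hnm (perz P f) (perz_per P f) r hr (bd2_perz hb)
  have h := h1.add h2
  rw [sub_add_sub_cancel] at h
  exact h.mono (by linarith)

/-- (E16) for the hybrid remainder, all arguments. [cite: Balaban1985RegularSpaces, p.93] -/
theorem hRreal_H (hn : 1 ≤ n) (hnm : n ≤ m) : ∀ f : Site d → 𝔸, (∀ j, j ≤ n → ∀ x ∈ (Set.univ : Set (Site d)), IsSelfAdjoint (f x)) →
    ∀ j, j ≤ n → ∀ x ∈ (Set.univ : Set (Site d)),
      IsSelfAdjoint ((f - gH lt n (QTₗ L n (torusLam (d := d) n) U₀ (cH lt n (qH lt n (gH lt n f))))) x) := by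
  intro f hf j hj x hx
  rw [remainder_H lt hn hnm f]
  have hpf : ∀ j, j ≤ n → ∀ x ∈ (Set.univ : Set (Site d)), IsSelfAdjoint (perz P f x) :=
    fun j hj z _ => hf j hj (pmod P z) (Set.mem_univ _)
  have h2 := lt.r_real n hn hnm (perz P f) (perz_per P f) hpf j hj x hx
  have h1 : IsSelfAdjoint (f x - perz P f x) := (hf j hj x hx).sub (hpf j hj x hx)
  have := h1.add h2
  simpa only [Pi.sub_apply, sub_add_sub_cancel] using this

variable (τ : 𝔸 →L[ℂ] ℂ)

/-- `τ`-law for `HH`, all arguments. [cite: Balaban1985RegularSpaces, p.76] -/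
theorem hHτ_H (hn : 1 ≤ n) (hnm : n ≤ m) (ltτ : LettersPerTau (𝔸 := 𝔸) τ lt) :
    ∀ X : XSpace d n 𝔸, (∀ p, τ (X p) = 0) → ∀ x, τ (HH lt n X x) = 0 := fun X hX x =>
  ltτ.hp_tau n hn hnm (perzX L P n X) (perzX_per L P n X) (fun p => by rw [perzX_apply]; exact hX _) x

/-- `τ`-law for `gH`, all arguments. [cite: Balaban1985RegularSpaces, p.76] -/
theorem hGτ_H (hn : 1 ≤ n) (hnm : n ≤ m) (ltτ : LettersPerTau (𝔸 := 𝔸) τ lt) :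
    ∀ f : Site d → 𝔸, (∀ j, j ≤ n → ∀ x ∈ (Set.univ : Set (Site d)), τ (f x) = 0) → ∀ x, τ (gH lt n f x) = 0 := fun f hf x => by
  rw [gH_apply]
  exact ltτ.gp_tau n hn hnm (perz P f) (perz_per P f) (fun j hj z _ => hf j hj (pmod P z) (Set.mem_univ _)) x

/-- `τ`-law for the hybrid remainder, all arguments. [cite: Balaban1985RegularSpaces, p.76, (1.98) p.92] -/
theorem hRτ_H (hn : 1 ≤ n) (hnm : n ≤ m) (ltτ : LettersPerTau (𝔸 := 𝔸) τ lt) :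
    ∀ f : Site d → 𝔸, (∀ j, j ≤ n → ∀ x ∈ (Set.univ : Set (Site d)), τ (f x) = 0) →
      ∀ j, j ≤ n → ∀ x ∈ (Set.univ : Set (Site d)),
        τ ((f - gH lt n (QTₗ L n (torusLam (d := d) n) U₀ (cH lt n (qH lt n (gH lt n f))))) x) = 0 := by
  intro f hf j hj x hx
  rw [remainder_H lt hn hnm f]
  have hpf : ∀ j, j ≤ n → ∀ x ∈ (Set.univ : Set (Site d)), τ (perz P f x) = 0 := fun j hj z _ => hf j hj (pmod P z) (Set.mem_univ _)
  have h2 := ltτ.r_tau n hn hnm (perz P f) (perz_per P f) hpf j hj x hx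
  rw [Pi.sub_apply, map_sub] at h2 ⊢
  rw [hpf j hj x hx] at h2
  rw [hf j hj x hx]
  linear_combination h2

end AllArgs

/-! ## §4 The identity laws at periodic arguments -/

section Identity

variable {𝔸 : Type*} [CStarAlgebra 𝔸]
variable {L : ℕ} {BG BR B₀'H B₂' B₀ B₀β cB β : ℝ} {len : Site d → ℝ} {η : ℝ} {m : ℕ} {α₀ : ℝ} {P : ℤ} {U₀ : Site d → Fin d → 𝔸ˣ}
variable (lt : LettersAtPer (𝔸 := 𝔸) L BG BR B₀'H B₂' B₀ B₀β cB β len η m α₀ P U₀) {n : ℕ}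

/-- **(E1) for the hybrid letters at PERIODIC arguments**: `Δ(gH x) + qsH(AwH(qH(gH x))) = x` pointwise ([4] Thm 3.1 on `T_η`).
[cite: Balaban1985BackgroundPropagators, Thm 3.1 p.397, (3.25) p.394; Balaban1985RegularSpaces, (1.95) p.92] -/
theorem g_rightΩ_H (hn : 1 ≤ n) (hnm : n ≤ m) : ∀ x : Site d → 𝔸, (∀ (z : Site d) (i : Fin d), x (z + P • e i) = x z) →
    ∀ y ∈ (Set.univ : Set (Site d)),
      (covLapₗ η U₀ (gH lt n x) + QTₗ L n (torusLam (d := d) n) U₀ (AwH lt n (qH lt n (gH lt n x)))) y = x y := by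
  intro x hx y hy
  have hg : gH lt n x = lt.Gp n x := gH_of_per lt hx
  have hgper : ∀ (z : Site d) (i : Fin d), lt.Gp n x (z + P • e i) = lt.Gp n x z := lt.gp_per n hn hnm x hx
  have hq : qH lt n (lt.Gp n x) = lt.Qp n (lt.Gp n x) := qH_of_per lt hn hnm hgper
  have hqper := lt.qp_per n hn hnm _ hgper
  have ha : AwH lt n (lt.Qp n (lt.Gp n x)) = lt.Aw n (lt.Qp n (lt.Gp n x)) := AwH_of_per lt hqper
  have haper := lt.aw_per n hn hnm _ hqper
  have hs : QTₗ L n (torusLam (d := d) n) U₀ (lt.Aw n (lt.Qp n (lt.Gp n x))) = lt.QpT n (lt.Aw n (lt.Qp n (lt.Gp n x))) :=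
    QTₗ_of_per lt hn hnm haper
  have hΔ : covLapₗ η U₀ (lt.Gp n x) = lt.lapU n (lt.Gp n x) := covLapₗ_of_per lt hn hnm hgper
  rw [hg, hq, ha, hs, hΔ]
  exact lt.gp_right n hn hnm x hx y hy

/-- **(E2) for the hybrid letters at PERIODIC arguments.** [cite: Balaban1985BackgroundPropagators, (3.25) p.394, Thm 3.2 p.398] -/
theorem c_range_H (hn : 1 ≤ n) (hnm : n ≤ m) : ∀ f : Site d → 𝔸, (∀ (z : Site d) (i : Fin d), f (z + P • e i) = f z) →
    qH lt n (gH lt n (gH lt n (QTₗ L n (torusLam (d := d) n) U₀ (cH lt n (qH lt n f))))) = qH lt n f := by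
  intro f hf
  have hq : qH lt n f = lt.Qp n f := qH_of_per lt hn hnm hf
  have hqper := lt.qp_per n hn hnm f hf
  have hc : cH lt n (lt.Qp n f) = lt.Cinv n (lt.Qp n f) := cH_of_per lt hqper
  have hcper := lt.cinv_per n hn hnm _ hqper
  have hs : QTₗ L n (torusLam (d := d) n) U₀ (lt.Cinv n (lt.Qp n f)) = lt.QpT n (lt.Cinv n (lt.Qp n f)) := QTₗ_of_per lt hn hnm hcper
  have hsper := lt.qpT_per n hn hnm _ hcper
  have hg1 : gH lt n (lt.QpT n (lt.Cinv n (lt.Qp n f))) = lt.Gp n (lt.QpT n (lt.Cinv n (lt.Qp n f))) := gH_of_per lt hsper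
  have hg1per := lt.gp_per n hn hnm _ hsper
  have hg2 : gH lt n (lt.Gp n (lt.QpT n (lt.Cinv n (lt.Qp n f)))) = lt.Gp n (lt.Gp n (lt.QpT n (lt.Cinv n (lt.Qp n f)))) :=
    gH_of_per lt hg1per
  have hg2per := lt.gp_per n hn hnm _ hg1per
  rw [hq, hc, hs, hg1, hg2, qH_of_per lt hn hnm hg2per]
  exact lt.cinv_range n hn hnm f hf

/-- **(E11) `Q′H′ = 1` for `HH` at level-PERIODIC families.** [cite: Balaban1985RegularSpaces, (1.91) p.91] -/
theorem hQH_H (hn : 1 ≤ n) (hnm : n ≤ m) : ∀ (Y : XSpace d n 𝔸),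
    (∀ (p : Fin (n + 1) × Site d) (i : Fin d), Y (p.1, p.2 + (P / (L : ℤ) ^ (p.1 : ℕ)) • e i) = Y p) →
    ∀ (j : ℕ) (hj : j ≤ n) (y : Site d), y ∈ torusLam (d := d) n j →
      QprimeIter (zdBlocking d L) (bgT L U₀) j (HH lt n Y) y = Y (⟨j, Nat.lt_succ_of_le hj⟩, y) := by
  intro Y hY j hj y hy
  rw [HH_of_per lt hY]
  exact lt.qp_hp n hn hnm Y hY j hj y hy

/-- **(U1) [4] Thm 3.1's LEFT-inverse law for `gH` on bounded PERIODIC functions, top structure** (the background `U₀` periodic).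
[cite: Balaban1985BackgroundPropagators, Thm 3.1 p.397] -/
theorem g_leftB_H (hm : 1 ≤ m) (hU₀ : ∀ (z : Site d) (i : Fin d), U₀ (z + P • e i) = U₀ z) :
    ∀ x : Site d → 𝔸, (∀ (z : Site d) (i : Fin d), x (z + P • e i) = x z) → (∃ C : ℝ, ∀ y, ‖x y‖ ≤ C) →
      gH lt m (covLapₗ η U₀ x + QTₗ L m (torusLam (d := d) m) U₀ (AwH lt m (qH lt m x))) = x := by
  intro x hx hC
  have hq : qH lt m x = lt.Qp m x := qH_of_per lt hm le_rfl hx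
  have hqper := lt.qp_per m hm le_rfl x hx
  have ha : AwH lt m (lt.Qp m x) = lt.Aw m (lt.Qp m x) := AwH_of_per lt hqper
  have haper := lt.aw_per m hm le_rfl _ hqper
  have hs : QTₗ L m (torusLam (d := d) m) U₀ (lt.Aw m (lt.Qp m x)) = lt.QpT m (lt.Aw m (lt.Qp m x)) := QTₗ_of_per lt hm le_rfl haper
  have hsper := lt.qpT_per m hm le_rfl _ haper
  have hΔ : covLapₗ η U₀ x = lt.lapU m x := covLapₗ_of_per lt hm le_rfl hx
  have hΔper : ∀ (z : Site d) (i : Fin d), lt.lapU m x (z + P • e i) = lt.lapU m x z := by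
    intro z i
    rw [← hΔ, covLapₗ_apply, covLapₗ_apply]
    exact covLap_per hU₀ hx z i
  have hsum : ∀ (z : Site d) (i : Fin d),
      (lt.lapU m x + lt.QpT m (lt.Aw m (lt.Qp m x))) (z + P • e i) = (lt.lapU m x + lt.QpT m (lt.Aw m (lt.Qp m x))) z := by
    intro z i
    rw [Pi.add_apply, Pi.add_apply, hΔper, hsper]
  rw [hq, ha, hs, hΔ, gH_of_per lt hsum]
  exact lt.gp_left_bdd hm x hx hC

/-- **(U2) the law of `C` in the `Q′ᵀ`-form for the hybrid letters at level-PERIODIC multipliers, top structure.**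
[cite: Balaban1985BackgroundPropagators, (3.25) p.394, Thm 3.2 p.398] -/
theorem c_left'_H (hm : 1 ≤ m) : ∀ φ : ℕ → Site d → 𝔸,
    (∀ j, j ≤ m → ∀ (y : Site d) (i : Fin d), φ j (y + (P / (L : ℤ) ^ j) • e i) = φ j y) →
    QTₗ L m (torusLam (d := d) m) U₀ (cH lt m (qH lt m (gH lt m (gH lt m (QTₗ L m (torusLam (d := d) m) U₀ φ))))) =
      QTₗ L m (torusLam (d := d) m) U₀ φ := by
  intro φ hφ
  have hs0 : QTₗ L m (torusLam (d := d) m) U₀ φ = lt.QpT m φ := QTₗ_of_per lt hm le_rfl hφ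
  have hs0per := lt.qpT_per m hm le_rfl φ hφ
  have hg1 : gH lt m (lt.QpT m φ) = lt.Gp m (lt.QpT m φ) := gH_of_per lt hs0per
  have hg1per := lt.gp_per m hm le_rfl _ hs0per
  have hg2 : gH lt m (lt.Gp m (lt.QpT m φ)) = lt.Gp m (lt.Gp m (lt.QpT m φ)) := gH_of_per lt hg1per
  have hg2per := lt.gp_per m hm le_rfl _ hg1per
  have hq : qH lt m (lt.Gp m (lt.Gp m (lt.QpT m φ))) = lt.Qp m (lt.Gp m (lt.Gp m (lt.QpT m φ))) := qH_of_per lt hm le_rfl hg2per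
  have hqper := lt.qp_per m hm le_rfl _ hg2per
  have hc : cH lt m (lt.Qp m (lt.Gp m (lt.Gp m (lt.QpT m φ)))) = lt.Cinv m (lt.Qp m (lt.Gp m (lt.Gp m (lt.QpT m φ)))) :=
    cH_of_per lt hqper
  have hcper := lt.cinv_per m hm le_rfl _ hqper
  rw [hs0, hg1, hg2, hq, hc, QTₗ_of_per lt hm le_rfl hcper]
  exact lt.cinv_range' hm φ hφ

end Identity

#print axioms hRbd_H
#print axioms g_rightΩ_H
#print axioms c_range_H
#print axioms g_leftB_H
#print axioms c_left'_H

end Literature.MathematicalPhysics.QuantumFieldTheory.Balaban1983to89.B8Thm2TorusLettersPerConv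

end
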